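import Summits.CriticalPhenomena.PercolationContinuityZ3.Theorems.FK.WeakMixingBelowCritical
import Summits.CriticalPhenomena.PercolationContinuityZ3.Theorems.FK.PlanarDualityWiredDual
import Summits.CriticalPhenomena.PercolationContinuityZ3.Theorems.FK.SelfDualPointNonPercolation
import HarnessLib

/-!
# EXPONENTIAL WEAK MIXING OF THE PLANAR RANDOM-CLUSTER MEASURE AT EVERY `p ≠ p_sd(q) = √q/(1+√q)`, `q ≥ 1`
# (the supercritical phase by planar duality: Alexander 1998, Remark 3.5)

Claimed R42 (8)(c) in the cell INBOX at 2026-08-28T10:00:12Z by fkp-10a gen 353 (NEW CLAIM #1 of the gen), under provision (ι) (no coordinator seated since gen 267's closing line l.8331: the lane lead absorbs the registry word, silence = consent; readers fk-ref / fkt-lead / fkp-18r / fkp-10b); lineage row FO-10a-g353 (self-suggested), package g353-weakmixing, label WM-E.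
Helper file of the `fk-continuity` build cell (bschramm lane; `--supports stmt-CriticalPhenomena-4575`); builds on
p205010 (kernel theorem, internal audit signed; external expert review pending). No definitions, no named facts, no
sorries; standard axioms. UNCONDITIONAL.

Alexander (1998), Remark 3.5: "in two dimensions, weak mixing for the FK model with parameters `q, p` is equivalent
to weak mixing for the corresponding measure on dual bonds, which is just the FK model with parameters `q, p*`, where
`p*` is dual to `p`". On `ℤ²` the lineage has `p_c(q) = p_sd(q) = √q/(1+√q)` for every `q ≥ 1`
(`rcCriticalProb_two_eq`), the measure identity `φ⁰_{p_d,q} ∘ (ω ↦ ω_d)⁻¹ = φ¹_{p,q}`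
(`map_dualConfig_rcLimit_false`, Grimmett 2006 Thm. (6.13)), uniqueness `φ⁰_{p,q} = φ¹_{p,q}` for `p ≠ p_sd(q)`
(`rcLimit_false_eq_rcLimit_true_of_ne_selfDual'`, Thm. (6.17)(b)) and the subcritical weak mixing of
`WeakMixingBelowCritical.lean`. For `p > p_sd(q)` the dual parameter `p_d` is subcritical; the dual of an event
determined inside `Λ_k` is determined inside `Λ_{k+1}`, the dual of an event determined off `E_{Λ_n}` is determined
off `E_{Λ_{n−2}}` (`map_dualEdgeEquiv_symm_subset_edgesIn_box_succ`, `disjoint_map_dualEdgeEquiv_symm_edgesIn`); hence: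

* `exists_exp_weakMixing_two_of_selfDual_lt` — **for `q ≥ 1` and `√q/(1+√q) < p ≤ 1` there is `c > 0` with
  `|φ^b_{p,q}(E ∩ H) − φ^b_{p,q}(E)·φ^b_{p,q}(H)| ≤ 4·φ^b_{p,q}(H)·|F|·e^{−c(n−k−3)}`** for both `b`, all `k + 3 < n`,
  every event `E` determined by `F ⊆ E_{Λ_k}` and every `H` determined by finitely many pairs off `E_{Λ_n}`;
* `exists_exp_weakMixing_two_of_ne_selfDual` — the same at EVERY `p ∈ [0,1] ∖ {p_sd(q)}` (subcritical side:
  `exists_exp_weakMixing_two_of_lt_selfDual`).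

HONEST FRAMING: planar and off `p_sd(q)` only; at `p_sd(q)` itself (critical: polynomial mixing for `1 ≤ q ≤ 4`,
coexistence for large `q`) nothing is claimed. Not a binder discharge; `n_open = 2` unchanged.

## References

* K. S. Alexander, *On weak mixing in lattice models*, PTRF 110 (1998) 441–471, (1.1), Thm. 3.4, Remark 3.5. [Alexander1998]
* G. Grimmett, *The Random-Cluster Model*, Springer 2006, §6.1 Thm. (6.13) eq. (6.12), §6.2 Thm. (6.17). [Grimmett2006]
* V. Beffara, H. Duminil-Copin, PTRF 153 (2012) 511–542, Thm. 1 (`p_c = p_sd` on `ℤ²`). [BeffaraDuminilCopin2012]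
* H. Duminil-Copin, A. Raoufi, V. Tassion, Ann. of Math. 189 (2019), Thm. 1.2 (1). [DuminilCopinRaoufiTassion2019]
-/

noncomputable section

namespace Summit.CriticalPhenomena.PercolationContinuityZ3.Theorems.FK

namespace BoundaryInfluence

open MeasureTheory Finset
open Literature.Probability.Percolation Literature.Probability.LatticeModels Literature.Barriers.CriticalPhenomena
open Literature.Probability.Percolation.OneArmOSSS Literature.Probability.Percolation.DCT16 MonotonicOSSS

variable {q p : ℝ}

/-! ### Geometry of the duality map on boxes -/

/-- `Λ_m ⊆ P_m = [-m, m+1]²` and `P_m ⊆ Λ_{m+1}`. [cite: Grimmett2006, §6.1 (Fig. 6.1)] -/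
theorem box_subset_pbox_subset_box (m : ℕ) : box 2 m ⊆ pbox m ∧ pbox m ⊆ box 2 (m + 1) := by
  constructor
  · intro x hx
    rw [mem_box] at hx; rw [mem_pbox]
    intro i; have := hx i; constructor <;> omega
  · intro x hx
    rw [mem_pbox] at hx; rw [mem_box]
    intro i; have := hx i; push_cast; constructor <;> omega

/-- `E_{Λ_m} ⊆` the touching edges of `Λ_{m+1}` and `E(P_m) ⊆ E_{Λ_{m+1}}`. [cite: Grimmett2006, §6.1 (Fig. 6.1)] -/
theorem edgesIn_box_subset_touchEdgesSite (m : ℕ) : edgesIn (zdGraph 2) (box 2 m) ⊆ touchEdgesSite m := by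
  intro e he
  rw [mem_edgesIn_iff] at he
  rw [mem_touchEdgesSite_iff]
  induction e using Sym2.ind with
  | h a b =>
    exact ⟨he.1, fun x hx => box_mono 2 (Nat.le_succ m) (he.2 x hx), a, Sym2.mem_mk_left a b, he.2 a (Sym2.mem_mk_left a b)⟩

/-- `E(P_m) ⊆ E_{Λ_{m+1}}`. [cite: Grimmett2006, §6.1 (Fig. 6.1)] -/
theorem pboxEdges_subset_edgesIn_box_succ (m : ℕ) : pboxEdges m ⊆ edgesIn (zdGraph 2) (box 2 (m + 1)) := by
  intro e he
  rw [mem_pboxEdges_iff] at he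
  rw [mem_edgesIn_iff]
  exact ⟨he.1, fun x hx => (box_subset_pbox_subset_box m).2 (he.2 x hx)⟩

/-- **The dual of an event determined inside `Λ_k` is determined inside `Λ_{k+1}`**: the primal edges crossed by the
edges of `E_{Λ_k}` lie in `E_{Λ_{k+1}}`. [cite: Grimmett2006, §6.1 (6.3) and (Fig. 6.1)] -/
theorem map_dualEdgeEquiv_symm_subset_edgesIn_box_succ {k : ℕ} {F : Finset (Sym2 (Site 2))}
    (hF : F ⊆ edgesIn (zdGraph 2) (box 2 k)) :
    F.map dualEdgeEquiv.symm.toEmbedding ⊆ edgesIn (zdGraph 2) (box 2 (k + 1)) := by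
  intro e he
  rw [Finset.mem_map] at he
  obtain ⟨f, hf, rfl⟩ := he
  exact pboxEdges_subset_edgesIn_box_succ k
    (dualEdgeEquiv_symm_mem_pboxEdges (edgesIn_box_subset_touchEdgesSite k (hF hf)))

/-- **The dual of an event determined off `E_{Λ_n}` is determined off `E_{Λ_{n−2}}`**: if a lattice edge `t` is not in
`E_{Λ_n}`, the primal edge crossed by `t` is not in `E_{Λ_{n−2}}` (else `t`, its dual, would touch `Λ_{n−2}` inside
`Λ_{n−1}`). [cite: Grimmett2006, §6.1 (6.3) and (Fig. 6.1)] -/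
theorem disjoint_map_dualEdgeEquiv_symm_edgesIn {n : ℕ} (hn : 2 ≤ n) {T : Finset (Sym2 (Site 2))}
    (hT : Disjoint (↑T : Set (Sym2 (Site 2))) ↑(edgesIn (zdGraph 2) (box 2 n))) :
    Disjoint (↑((T.filter fun e => e ∈ (zdGraph 2).edgeSet).map dualEdgeEquiv.symm.toEmbedding) : Set (Sym2 (Site 2)))
      ↑(edgesIn (zdGraph 2) (box 2 (n - 2))) := by
  rw [Finset.disjoint_coe, Finset.disjoint_left]
  intro e he heΛ
  rw [Finset.mem_map] at he
  obtain ⟨t, ht, rfl⟩ := he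
  rw [Finset.mem_filter] at ht
  -- `t = dualEdge (dualEdgeEquiv.symm t)` touches `Λ_{n-2}` inside `Λ_{n-1}`
  have h1 : dualEdgeEquiv.symm t ∈ pboxEdges (n - 2) := by
    rw [mem_pboxEdges_iff]
    have h := mem_edgesIn_iff.1 heΛ
    exact ⟨h.1, fun x hx => (box_subset_pbox_subset_box (n - 2)).1 (h.2 x hx)⟩
  have h2 : t ∈ touchEdgesSite (n - 2) := by
    have := dualEdge_mem_touchEdgesSite h1
    rwa [← dualEdgeEquiv_apply, Equiv.apply_symm_apply] at this
  have h3 : t ∈ edgesIn (zdGraph 2) (box 2 n) := by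
    rw [mem_touchEdgesSite_iff] at h2
    rw [mem_edgesIn_iff]
    exact ⟨ht.2, fun x hx => box_mono 2 (by omega) (h2.2.1 x hx)⟩
  exact Finset.disjoint_left.1 (Finset.disjoint_coe.1 hT) ht.1 h3

/-! ### Weak mixing above `p_sd(q)` by duality, and at every `p ≠ p_sd(q)` -/

/-- **EXPONENTIAL WEAK MIXING OF THE PLANAR RANDOM-CLUSTER MEASURE ABOVE `p_sd(q)`**: for `q ≥ 1` and
`√q/(1+√q) < p ≤ 1` there is `c > 0` such that for both boundary conditions `b`, all `k + 3 < n`, every event `E`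
determined by `F ⊆ E_{Λ_k}` and every `H` determined by finitely many pairs off `E_{Λ_n}`:
`|φ^b_{p,q}(E ∩ H) − φ^b_{p,q}(E)·φ^b_{p,q}(H)| ≤ 4·φ^b_{p,q}(H)·|F|·e^{−c(n−k−3)}` — the dual measure `φ⁰_{p_d,q}`,
`p_d < p_sd(q) = p_c(q)`, is subcritical and weak mixing, and `ω ↦ ω_d` carries events in `Λ_k` / off `Λ_n` to events
in `Λ_{k+1}` / off `Λ_{n−2}`. [cite: Alexander1998, Remark 3.5 and Thm. 3.4; Grimmett2006, §6.1 Thm. (6.13), §6.2 Thm. (6.17)(b); DuminilCopinRaoufiTassion2019, Thm. 1.2 (1)] -/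
theorem exists_exp_weakMixing_two_of_selfDual_lt (hq : 1 ≤ q) (hpsd : Real.sqrt q / (1 + Real.sqrt q) < p)
    (hp1 : p ≤ 1) :
    ∃ c : ℝ, 0 < c ∧ ∀ (b : Bool) ⦃k n : ℕ⦄, k + 3 < n →
      ∀ ⦃F : Finset (Sym2 (Site 2))⦄, F ⊆ edgesIn (zdGraph 2) (box 2 k) →
      ∀ ⦃E : Set (BondConfig (Site 2))⦄, DeterminedBy E ↑F →
      ∀ ⦃H : Set (BondConfig (Site 2))⦄ (T : Finset (Sym2 (Site 2))),
        Disjoint (↑T : Set (Sym2 (Site 2))) ↑(edgesIn (zdGraph 2) (box 2 n)) → DeterminedBy H ↑T →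
          |(rcLimit 2 b p q).real (E ∩ H) - (rcLimit 2 b p q).real E * (rcLimit 2 b p q).real H| ≤
            4 * (rcLimit 2 b p q).real H * #F * Real.exp (-(c * ((n : ℝ) - k - 3))) := by
  have hq0 : 0 < q := one_pos.trans_le hq
  have hs0 : 0 ≤ Real.sqrt q / (1 + Real.sqrt q) := by positivity
  have hp : p ∈ Set.Icc (0 : ℝ) 1 := ⟨hs0.trans hpsd.le, hp1⟩
  have hp' : rcDualParam p q ∈ Set.Icc (0 : ℝ) 1 := rcDualParam_mem_Icc hp hq0
  have hp'c : rcDualParam p q < rcCriticalProb 2 q := by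
    rw [rcCriticalProb_two_eq hq]; exact (rcDualParam_lt_iff hp hq0).2 hpsd
  obtain ⟨c, hc, hwm⟩ := exists_exp_weakMixing_local_of_lt_rcCriticalProb (d := 2) le_rfl hq hp'.1 hp'c
  refine ⟨c, hc, fun b k n hkn F hF E hE H T hT hH => ?_⟩
  -- uniqueness off `p_sd`: reduce to the wired measure
  have hb : rcLimit 2 b p q = rcLimit 2 true p q := by
    cases b
    · exact rcLimit_false_eq_rcLimit_true_of_ne_selfDual' hp hq (ne_of_gt hpsd)
    · rfl
  rw [hb]
  -- duality: `φ¹_{p,q} = φ⁰_{p_d,q} ∘ (ω ↦ ω_d)⁻¹`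
  set Q : Measure (BondConfig (Site 2)) := rcLimit 2 false (rcDualParam p q) q with hQdef
  have hdual : Q.map dualConfig = rcLimit 2 true p q := by
    rw [hQdef, map_dualConfig_rcLimit_false hp' hq, rcDualParam_rcDualParam hp hq0]
  have hQ : FKGibbs 2 (rcDualParam p q) q Q := (isBoxLimit_rcLimit false hp' hq).fkGibbs hp' hq
  have hEm : MeasurableSet E := hE.measurableSet_of_finset
  have hHm : MeasurableSet H := hH.measurableSet_of_finset
  have hreal : ∀ X : Set (BondConfig (Site 2)), MeasurableSet X → (rcLimit 2 true p q).real X = Q.real (dualConfig ⁻¹' X) :=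
    fun X hX => by rw [← hdual, map_measureReal_apply measurable_dualConfig hX]
  -- the dual events
  have hF' := map_dualEdgeEquiv_symm_subset_edgesIn_box_succ hF
  have hE' : DeterminedBy (dualConfig ⁻¹' E) ↑(F.map dualEdgeEquiv.symm.toEmbedding) := determinedBy_preimage_dualConfig hE
  have hH' : DeterminedBy (dualConfig ⁻¹' H)
      ↑((T.filter fun e => e ∈ (zdGraph 2).edgeSet).map dualEdgeEquiv.symm.toEmbedding) := by
    rw [← preimage_dualConfig_latticePart H]
    exact determinedBy_preimage_dualConfig (determinedBy_latticePart_filter hH)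
  have hT' := disjoint_map_dualEdgeEquiv_symm_edgesIn (n := n) (by omega) hT
  have key := hwm hQ (k := k + 1) (n := n - 2) (by omega) hF' hE' _ hT' hH'
  rw [← Set.preimage_inter, ← hreal _ (hEm.inter hHm), ← hreal _ hEm, ← hreal _ hHm, Finset.card_map] at key
  have hcast : ((n - 2 : ℕ) : ℝ) - ((k + 1 : ℕ) : ℝ) = (n : ℝ) - k - 3 := by
    rw [Nat.cast_sub (by omega), Nat.cast_add]; push_cast; ring
  rwa [hcast] at key

/-- **EXPONENTIAL WEAK MIXING OF THE PLANAR RANDOM-CLUSTER MEASURE AT EVERY `p ≠ p_sd(q)`** (`q ≥ 1`, `p ∈ [0,1]`,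
both boundary conditions; the subcritical side is `exists_exp_weakMixing_two_of_lt_selfDual`, the supercritical side
duality): `|φ^b_{p,q}(E ∩ H) − φ^b_{p,q}(E)·φ^b_{p,q}(H)| ≤ 4·φ^b_{p,q}(H)·|F|·e^{−c(n−k−3)}` for `k + 3 < n`.
[cite: Alexander1998, Thm. 3.4 and Remark 3.5; Grimmett2006, §6.2 Thm. (6.17); BeffaraDuminilCopin2012, Thm. 1] -/
theorem exists_exp_weakMixing_two_of_ne_selfDual (hq : 1 ≤ q) (hp : p ∈ Set.Icc (0 : ℝ) 1)
    (hne : p ≠ Real.sqrt q / (1 + Real.sqrt q)) :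
    ∃ c : ℝ, 0 < c ∧ ∀ (b : Bool) ⦃k n : ℕ⦄, k + 3 < n →
      ∀ ⦃F : Finset (Sym2 (Site 2))⦄, F ⊆ edgesIn (zdGraph 2) (box 2 k) →
      ∀ ⦃E : Set (BondConfig (Site 2))⦄, DeterminedBy E ↑F →
      ∀ ⦃H : Set (BondConfig (Site 2))⦄ (T : Finset (Sym2 (Site 2))),
        Disjoint (↑T : Set (Sym2 (Site 2))) ↑(edgesIn (zdGraph 2) (box 2 n)) → DeterminedBy H ↑T →
          |(rcLimit 2 b p q).real (E ∩ H) - (rcLimit 2 b p q).real E * (rcLimit 2 b p q).real H| ≤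
            4 * (rcLimit 2 b p q).real H * #F * Real.exp (-(c * ((n : ℝ) - k - 3))) := by
  rcases lt_or_gt_of_ne hne with hlt | hgt
  · -- subcritical: every FK-Gibbs measure, in particular both box limits
    obtain ⟨c, hc, h⟩ := exists_exp_weakMixing_two_of_lt_selfDual hq hp.1 hlt
    refine ⟨c, hc, fun b k n hkn F hF E hE H T hT hH => ?_⟩
    have hP : FKGibbs 2 p q (rcLimit 2 b p q) := (isBoxLimit_rcLimit b hp hq).fkGibbs hp hq
    refine (h hP (show k < n by omega) hF hE T hT hH).trans ?_
    have h0 : 0 ≤ 4 * (rcLimit 2 b p q).real H * #F := by positivity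
    exact mul_le_mul_of_nonneg_left (Real.exp_le_exp.2 (by nlinarith)) h0
  · exact exists_exp_weakMixing_two_of_selfDual_lt hq hgt hp.2

end BoundaryInfluence

end Summit.CriticalPhenomena.PercolationContinuityZ3.Theorems.FK

end
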